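import Summits.QuantumAdvantage.QuantumAdvantage.Theorems.SosSandwichPseudoBoundedAABooleanCornerOSSS
import Literature.Computability.Complexity.MidrijanisBound
import Literature.Computability.QuantumComplexity.BlockSensitivityQuantumBound
import Literature.Computability.QuantumComplexity.PseudoBounded
import HarnessLib

/-!
# Crux `PseudoBoundedAA` (stmt-QuantumAdvantage-15237, route SosSandwich) — THE BOOLEAN CORNER OF PB-AA, in kernel

Support file 2/2 (file 1/2: `SosSandwichPseudoBoundedAABooleanCornerOSSS.lean`, OSSS in depth form for the tree's
`DecisionTree`/`detQueryComplexity`). The route file `Theses/SosSandwich.lean` lists under "NOT DECOMPOSED YET":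
*the Boolean corner `f = f² ∈ K_deg` (known with exponents `Var/deg³` by OSSS + Midrijanis)*. This file proves it:

* `exists_totalDegree_le_of_pseudoBounded` — a member of the sandwich class `K_T` (`PseudoBounded T p`) agrees on the
  cube with a polynomial of total degree `≤ 2T` (its SOS certificate);
* `blockSensitivity_le_of_pseudoBounded`, `booleanDegree_le_of_pseudoBounded`, `detQueryComplexity_le_of_pseudoBounded`
  — a `{0,1}`-valued member of `K_T`, read as a total Boolean function `f`, has `bs(f) ≤ 16T²` (core of Beals et al.
  Thm 4.13 = Nisan–Szegedy on the exactly representing polynomial), `deg(f) ≤ 2T`, hence `D(f) ≤ bs·deg ≤ 32T³`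
  (Midrijanis, tree theorem `detQueryComplexity_le_blockSensitivity_mul_booleanDegree`);
* `exists_influence_ge_of_boolean` — with OSSS (file 1/2): `Var[p] ≤ 8T³ · maxᵢ Infᵢ[p]`;
* **`pseudoBoundedAA_booleanCorner`** — the body of the route item `PseudoBoundedAA` in its LITERAL inline vocabulary,
  with the single extra hypothesis "`p` is `{0,1}`-valued on the cube", and constants `(c, C) = (3, 1/8)`:
  `∀ N T p ε, 1 ≤ T → p ∈ K_T → (∀ x, p(x) ∈ {0,1}) → 0 < ε ≤ Var[p] → ∃ i, (1/8)(ε/T)³ ≤ Inf_i[p]`;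
* the ROBUST corner (pure OSSS, no pseudo-boundedness of `p`): `exists_influence_ge_of_near_boolean` — any real
  polynomial `p` within a quarter of its variance (in `L²`) of a total Boolean `f` has `4 Var[p]² ≤ D(f)²·maxⱼ Infⱼ[p]`;
  `exists_influence_ge_of_near_booleanCorner` — hence `Var[p]² ≤ 256 T⁶ · maxⱼ Infⱼ[p]` whenever `p` is that close to a
  `{0,1}`-valued member of `K_T`.

Reading for the crux (honest label): PB-AA itself is open-problem class; by the tree's
`CornerLift.pseudoBoundedAA_iff_topBand` (file `SosSandwichCornerLiftD.lean`) it is EQUIVALENT to its slice in the top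
variance band `Var[p] ≥ 1/4 − η` — near-Boolean, near-balanced members of `K_T` — so the crux is exactly the
ROBUSTNESS of the Boolean-corner theorem proved here; the robust corner says the only possible failures are members of
`K_T` that are `L²`-far (more than half a standard deviation) from every total Boolean function of decision-tree
complexity `poly(T)`. Nothing here proves the crux or the summit.

All proved, no named fact; axioms `propext`, `Classical.choice`, `Quot.sound`. Sources: R. O'Donnell, M. Saks,
O. Schramm, R. Servedio, FOCS 2005 (arXiv:cs/0508071) Thm 1.1/3.2; G. Midrijanis, arXiv:quant-ph/0403168 (2004) Thm 4;
R. Beals, H. Buhrman, R. Cleve, M. Mosca, R. de Wolf, J. ACM 48 (2001) Thm 4.13; N. Nisan, M. Szegedy, Comput.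
Complexity 4 (1994) Lemma 3.8; S. Aaronson, A. Ambainis, Theory Comput. 10 (2014) (arXiv:0911.0996) Conj. 6 and §1;
J. Kaniewski, T. Lee, R. de Wolf, ICALP 2015 (arXiv:1411.7280) Def. 7.
-/

set_option linter.dupNamespace false

noncomputable section

namespace Summit.QuantumAdvantage.QuantumAdvantage.Theorems.SosSandwich

open Finset Function
open Literature.Computability.Complexity Literature.Computability.QuantumComplexity

namespace BooleanCorner

variable {N : ℕ}

/-! ### Boolean members of `K_T`: `bs(f) ≤ 16T²`, `deg(f) ≤ 2T`, `D(f) ≤ 32T³` -/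

/-- The Fourier degree is at most `d` when all coefficients above level `d` vanish. [folklore] -/
theorem fourierDegree_le_of_forall {g : (Fin N → Bool) → ℝ} {d : ℕ}
    (h : ∀ S : Finset (Fin N), d < S.card → LowDegree.cubeFourierCoeff g S = 0) : fourierDegree g ≤ d := by
  classical
  unfold fourierDegree
  refine Finset.sup_le fun S hS => ?_
  rw [Finset.mem_filter] at hS
  by_contra hlt
  exact hS.2 (h S (not_le.mp hlt))

variable {T : ℕ} {p : MvPolynomial (Fin N) ℝ}

/-- **A pseudo-bounded polynomial of order `T` agrees on the cube with a polynomial of total degree `≤ 2T`** (its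
SOS certificate `Σ_j q_j²`). [cite: KaniewskiLeeDewolf2015, Def. 7] -/
theorem exists_totalDegree_le_of_pseudoBounded (h : PseudoBounded T p) :
    ∃ P : MvPolynomial (Fin N) ℝ, P.totalDegree ≤ 2 * T ∧ ∀ x, evalBool P x = evalBool p x := by
  obtain ⟨m, q, r, hdeg, hval⟩ := h
  refine ⟨∑ j, q j ^ 2, ?_, fun x => ?_⟩
  · refine (MvPolynomial.totalDegree_finsetSum _ _).trans (Finset.sup_le fun j _ => ?_)
    calc (q j ^ 2).totalDegree ≤ 2 * (q j).totalDegree := MvPolynomial.totalDegree_pow _ _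
      _ ≤ 2 * T := Nat.mul_le_mul_left 2 (hdeg j).1
  · unfold evalBool
    rw [map_sum, (hval x).1]
    exact Finset.sum_congr rfl fun j _ => by rw [map_pow]

/-- **Block sensitivity of a Boolean member of `K_T`**: if `p ∈ K_T` takes on the cube the `0/1` values of the
total Boolean function `f`, then `bs(f) ≤ 16 T²` (Nisan–Szegedy `bs ≤ 4·deg²` in the form of the core of Beals et
al., Thm. 4.13, applied to the exactly representing polynomial of total degree `≤ 2T`).
[cite: BealsEtAl2001, Thm 4.13 (proof)] [cite: NisanSzegedy1994, Lemma 3.8] -/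
theorem blockSensitivity_le_of_pseudoBounded (h : PseudoBounded T p) (f : (Fin N → Bool) → Bool)
    (hpf : ∀ x, evalBool p x = realOf f x) : blockSensitivity f ≤ 16 * T ^ 2 := by
  classical
  obtain ⟨P, hPdeg, hP⟩ := exists_totalDegree_le_of_pseudoBounded h
  have hP01 : ∀ z : Fin N → Bool, 0 ≤ MvPolynomial.eval (Multilinear.boolPt (R := ℝ) z) P ∧
      MvPolynomial.eval (Multilinear.boolPt (R := ℝ) z) P ≤ 1 := by
    intro z
    change 0 ≤ evalBool P z ∧ evalBool P z ≤ 1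
    rw [hP z, hpf z, realOf_apply]
    split_ifs <;> norm_num
  obtain ⟨x, B, hsens, hdisj⟩ := exists_blocks_of_blockSensitivity f
  rcases Nat.eq_zero_or_pos (blockSensitivity f) with hb0 | hb1
  · rw [hb0]; exact Nat.zero_le _
  suffices hs : blockSensitivity f ≤ 4 * (2 * T) ^ 2 by
    calc blockSensitivity f ≤ 4 * (2 * T) ^ 2 := hs
      _ = 16 * T ^ 2 := by ring
  cases hfx : f x with
  | false =>
    -- `P(x) = 0 ≤ 1/3` and `P = 1 ≥ 2/3` on the flipped blocks
    refine card_le_four_mul_sq_of_approx x hdisj P hPdeg hP01 ?_ ?_ hb1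
    · change evalBool P x ≤ 1 / 3
      rw [hP x, hpf x, realOf_apply, hfx]; norm_num
    · intro j
      have hfj : f (flipBlock x (B j)) = true := by
        have := hsens j; rw [hfx] at this; simpa using this
      change 2 / 3 ≤ evalBool P (flipBlock x (B j))
      rw [hP, hpf, realOf_apply, hfj]; norm_num
  | true =>
    -- use `1 - P`
    refine card_le_four_mul_sq_of_approx x hdisj (1 - P) ?_ ?_ ?_ ?_ hb1
    · exact (MvPolynomial.totalDegree_sub _ _).trans (max_le (by simp) hPdeg)
    · intro z
      simp only [map_sub, map_one]
      constructor <;> linarith [(hP01 z).1, (hP01 z).2]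
    · simp only [map_sub, map_one]
      change 1 - evalBool P x ≤ 1 / 3
      rw [hP x, hpf x, realOf_apply, hfx]; norm_num
    · intro j
      have hfj : f (flipBlock x (B j)) = false := by
        have := hsens j; rw [hfx] at this; simpa using this
      simp only [map_sub, map_one]
      change 2 / 3 ≤ 1 - evalBool P (flipBlock x (B j))
      rw [hP, hpf, realOf_apply, hfj]; norm_num

/-- **Degree of a Boolean member of `K_T`**: `deg(f) ≤ 2T` (a polynomial of total degree `≤ 2T` has no Fourier
weight above level `2T`). [cite: ODonnell2014, §1.2] [cite: KaniewskiLeeDewolf2015, Def. 7] -/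
theorem booleanDegree_le_of_pseudoBounded (h : PseudoBounded T p) (f : (Fin N → Bool) → Bool)
    (hpf : ∀ x, evalBool p x = realOf f x) : booleanDegree f ≤ 2 * T := by
  obtain ⟨P, hPdeg, hP⟩ := exists_totalDegree_le_of_pseudoBounded h
  have hfun : realOf f = evalBool P := funext fun x => by rw [← hpf x, hP x]
  unfold booleanDegree
  rw [hfun]
  exact fourierDegree_le_of_forall fun S hS => cubeFourierCoeff_evalBool_eq_zero hPdeg hS

/-- **Deterministic query complexity of a Boolean member of `K_T`**: `D(f) ≤ bs(f) · deg(f) ≤ 16T² · 2T = 32 T³`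
(Midrijanis) — a total Boolean function with two-sided sum-of-squares degree `≤ T` has `D(f) ≤ 32 T³`.
[cite: Midrijanis2004, Thm 4 (proof)] [cite: BealsEtAl2001, Thm 4.13 (proof)] -/
theorem detQueryComplexity_le_of_pseudoBounded (h : PseudoBounded T p) (f : (Fin N → Bool) → Bool)
    (hpf : ∀ x, evalBool p x = realOf f x) : detQueryComplexity f ≤ 32 * T ^ 3 := by
  calc detQueryComplexity f ≤ blockSensitivity f * booleanDegree f :=
        detQueryComplexity_le_blockSensitivity_mul_booleanDegree f
    _ ≤ (16 * T ^ 2) * (2 * T) :=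
        Nat.mul_le_mul (blockSensitivity_le_of_pseudoBounded h f hpf) (booleanDegree_le_of_pseudoBounded h f hpf)
    _ = 32 * T ^ 3 := by ring

/-! ### The Boolean corner of PB-AA -/

/-- **PB-AA on the Boolean corner, tree vocabulary.** A pseudo-bounded `p` of order `T` that is `{0,1}`-VALUED on the
cube and non-constant has a variable with `Var[p] ≤ 8 T³ · Inf_i[p]`, i.e. `maxᵢ Infᵢ[p] ≥ Var[p] / (8 T³)`
(OSSS `Var ≤ D · maxInf / 4` with `D(f) ≤ 32 T³`). [cite: OdonnellEtAl2005, Thm 1.1] [cite: Midrijanis2004, Thm 4]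
[cite: AaronsonAmbainis2014, §1 (Conj. 6 and the remark on Boolean functions)] -/
theorem exists_influence_ge_of_boolean (h : PseudoBounded T p) (hbool : ∀ x, evalBool p x = 0 ∨ evalBool p x = 1)
    (hv : 0 < boolVariance p) : ∃ i : Fin N, boolVariance p ≤ 8 * (T : ℝ) ^ 3 * influence i p := by
  classical
  set f : (Fin N → Bool) → Bool := fun x => decide (evalBool p x = 1) with hf
  have hpf : ∀ x, evalBool p x = realOf f x := by
    intro x
    rw [realOf_apply]
    rcases hbool x with h0 | h1
    · rw [h0]; simp [hf, h0]
    · rw [h1]; simp [hf, h1]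
  obtain ⟨j, hj⟩ := exists_influence_ge_of_decisionTree p f hpf hv
  refine ⟨j, hj.trans ?_⟩
  have hD : (detQueryComplexity f : ℝ) ≤ 32 * (T : ℝ) ^ 3 := by
    exact_mod_cast detQueryComplexity_le_of_pseudoBounded h f hpf
  have hI := influence_nonneg j p
  nlinarith

/-- The variance of a pseudo-bounded polynomial is at most `1` (its cube values lie in `[0,1]`). [folklore] -/
theorem boolVariance_le_one (h : PseudoBounded T p) : boolVariance p ≤ 1 := by
  have h2 : (0 : ℝ) < (2 : ℝ) ^ N := by positivity
  have hb := h.bounded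
  have hμ0 : 0 ≤ boolAvg (evalBool p) := by
    unfold boolAvg; exact div_nonneg (Finset.sum_nonneg fun x _ => (hb x).1) h2.le
  have hμ1 : boolAvg (evalBool p) ≤ 1 := by
    unfold boolAvg
    rw [div_le_one h2]
    calc ∑ x, evalBool p x ≤ ∑ _x : Fin N → Bool, (1 : ℝ) := Finset.sum_le_sum fun x _ => (hb x).2
      _ = (2 : ℝ) ^ N := by
        rw [Finset.sum_const, Finset.card_univ, card_cube_nat, nsmul_eq_mul, mul_one]; push_cast; ring
  unfold boolVariance
  unfold boolAvg at hμ0 hμ1 ⊢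
  rw [div_le_one h2]
  calc ∑ x, (evalBool p x - (∑ x, evalBool p x) / (2 : ℝ) ^ N) ^ 2 ≤ ∑ _x : Fin N → Bool, (1 : ℝ) := by
        refine Finset.sum_le_sum fun x _ => ?_
        have h0 : 0 ≤ evalBool p x := (hb x).1
        have h1 : evalBool p x ≤ 1 := (hb x).2
        have : |evalBool p x - (∑ x, evalBool p x) / (2 : ℝ) ^ N| ≤ 1 := by
          rw [abs_le]; constructor <;> linarith
        calc (evalBool p x - (∑ x, evalBool p x) / (2 : ℝ) ^ N) ^ 2
            = |evalBool p x - (∑ x, evalBool p x) / (2 : ℝ) ^ N| ^ 2 := (sq_abs _).symm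
          _ ≤ 1 ^ 2 := pow_le_pow_left₀ (abs_nonneg _) this 2
          _ = 1 := one_pow 2
    _ = (2 : ℝ) ^ N := by
        rw [Finset.sum_const, Finset.card_univ, card_cube_nat, nsmul_eq_mul, mul_one]; push_cast; ring

/-- **THE BOOLEAN CORNER OF PB-AA** (literal inline vocabulary of the route item `SosSandwich.PseudoBoundedAA`,
stmt-QuantumAdvantage-15237, with ONE extra hypothesis: "`p` is `{0,1}`-valued on the cube"): the body of PB-AA holds
with `(c, C) = (3, 1/8)` — for every `N`, `T ≥ 1`, every `p` pseudo-bounded of order `T` and Boolean-valued on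
`{0,1}^N`, and every `0 < ε ≤ Var[p]`, some variable has `(1/8)·(ε/T)³ ≤ Inf_i[p]`. This is the route file's
"NOT DECOMPOSED YET" item *the Boolean corner `f = f² ∈ K_deg` (known with exponents `Var/deg³` by OSSS + Midrijanis)*,
in kernel; by `CornerLift.pseudoBoundedAA_iff_topBand` the crux itself is the ROBUSTNESS of this statement to the top
variance band `Var[p] ≥ 1/4 − η`. [cite: OdonnellEtAl2005, Thm 1.1] [cite: Midrijanis2004, Thm 4]
[cite: BealsEtAl2001, Thm 4.13] [cite: AaronsonAmbainis2014, Conj. 6 and the remark on Boolean functions] -/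
theorem pseudoBoundedAA_booleanCorner (N T : ℕ) (p : MvPolynomial (Fin N) ℝ) (ε : ℝ) :
    let ev : MvPolynomial (Fin N) ℝ → (Fin N → Bool) → ℝ :=
      fun f x => MvPolynomial.eval (fun k => if x k then (1 : ℝ) else 0) f
    let avg : ((Fin N → Bool) → ℝ) → ℝ := fun g => (∑ x : Fin N → Bool, g x) / (2 : ℝ) ^ N
    1 ≤ T →
    (∃ (m : ℕ) (q r : Fin m → MvPolynomial (Fin N) ℝ),
        (∀ j, (q j).totalDegree ≤ T ∧ (r j).totalDegree ≤ T) ∧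
          ∀ x : Fin N → Bool, ev p x = ∑ j, ev (q j) x ^ 2 ∧ 1 - ev p x = ∑ j, ev (r j) x ^ 2) →
    (∀ x : Fin N → Bool, ev p x = 0 ∨ ev p x = 1) →
    0 < ε → ε ≤ (avg fun x => (ev p x - avg (ev p)) ^ 2) →
    ∃ i : Fin N, (1 / 8) * (ε / T) ^ 3 ≤ (avg fun x => (ev p x - ev p (Function.update x i (!x i))) ^ 2) := by
  intro ev avg hT hpb hbool hε hεV
  have hpb' : PseudoBounded T p := hpb
  have hεV' : ε ≤ boolVariance p := hεV
  have hv : 0 < boolVariance p := lt_of_lt_of_le hε hεV'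
  obtain ⟨i, hi⟩ := exists_influence_ge_of_boolean hpb' hbool hv
  refine ⟨i, ?_⟩
  change (1 / 8) * (ε / T) ^ 3 ≤ influence i p
  have hV1 : boolVariance p ≤ 1 := boolVariance_le_one hpb'
  have hε1 : ε ≤ 1 := hεV'.trans hV1
  have hT1 : (1 : ℝ) ≤ T := by exact_mod_cast hT
  have hT3 : (0 : ℝ) < (T : ℝ) ^ 3 := by positivity
  have hε3 : ε ^ 3 ≤ ε := pow_le_of_le_one hε.le hε1 (by norm_num)
  have hI := influence_nonneg i p
  have hmain : boolVariance p / (T : ℝ) ^ 3 ≤ 8 * influence i p := by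
    rw [div_le_iff₀ hT3]; linarith
  calc (1 / 8) * (ε / T) ^ 3 = (1 / 8) * (ε ^ 3 / (T : ℝ) ^ 3) := by rw [div_pow]
    _ ≤ (1 / 8) * (ε / (T : ℝ) ^ 3) := by gcongr
    _ ≤ (1 / 8) * (boolVariance p / (T : ℝ) ^ 3) := by gcongr
    _ ≤ influence i p := by linarith

/-! ### The robust corner: `L²`-closeness to ANY shallow total Boolean function suffices (pure OSSS) -/

/-- Cauchy–Schwarz step: if `4 Σ (g − F)² ≤ V := Σ (g − μ)²` then `Σ (F − μ)(g − μ) ≥ V/2`. [folklore] -/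
theorem half_var_le_sum_centered_mul (F g : (Fin N → Bool) → ℝ) (μ : ℝ)
    (happrox : 4 * ∑ y, (g y - F y) ^ 2 ≤ ∑ y, (g y - μ) ^ 2) :
    (∑ y, (g y - μ) ^ 2) / 2 ≤ ∑ y, (F y - μ) * (g y - μ) := by
  have hV0 : 0 ≤ ∑ y, (g y - μ) ^ 2 := Finset.sum_nonneg fun _ _ => sq_nonneg _
  have hcs : (∑ y, (g y - F y) * (g y - μ)) ^ 2 ≤ (∑ y, (g y - F y) ^ 2) * ∑ y, (g y - μ) ^ 2 :=
    Finset.sum_mul_sq_le_sq_mul_sq _ _ _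
  have ha : (∑ y, (g y - F y) * (g y - μ)) ^ 2 ≤ ((∑ y, (g y - μ) ^ 2) / 2) ^ 2 := by
    calc (∑ y, (g y - F y) * (g y - μ)) ^ 2 ≤ (∑ y, (g y - F y) ^ 2) * ∑ y, (g y - μ) ^ 2 := hcs
      _ ≤ ((∑ y, (g y - μ) ^ 2) / 4) * ∑ y, (g y - μ) ^ 2 := mul_le_mul_of_nonneg_right (by linarith) hV0
      _ = ((∑ y, (g y - μ) ^ 2) / 2) ^ 2 := by ring
  have ha' : ∑ y, (g y - F y) * (g y - μ) ≤ (∑ y, (g y - μ) ^ 2) / 2 := (abs_le_of_sq_le_sq' ha (by linarith)).2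
  have hid : ∑ y, (F y - μ) * (g y - μ) = (∑ y, (g y - μ) ^ 2) - ∑ y, (g y - F y) * (g y - μ) := by
    rw [← Finset.sum_sub_distrib]
    exact Finset.sum_congr rfl fun y _ => by ring
  rw [hid]
  linarith

/-- Cauchy–Schwarz on the cube: `(Σ |d|)² ≤ 2^N · Σ d²`. [folklore] -/
theorem sq_sum_abs_le (d : (Fin N → Bool) → ℝ) : (∑ z, |d z|) ^ 2 ≤ (2 : ℝ) ^ N * ∑ z, d z ^ 2 := by
  calc (∑ z, |d z|) ^ 2 = (∑ z, |d z| * 1) ^ 2 := by simp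
    _ ≤ (∑ z, |d z| ^ 2) * ∑ _z : Fin N → Bool, (1 : ℝ) ^ 2 := Finset.sum_mul_sq_le_sq_mul_sq _ _ _
    _ = (2 : ℝ) ^ N * ∑ z, d z ^ 2 := by
        rw [one_pow, Finset.sum_const, Finset.card_univ, card_cube_nat, nsmul_eq_mul, mul_one]
        simp only [sq_abs]; push_cast; ring

/-- The squared increments of any polynomial in direction `j` sum to `2^N · Inf_j[p]`. [folklore] -/
theorem sum_sq_update_eq_influence (p : MvPolynomial (Fin N) ℝ) (j : Fin N) :
    ∑ x, (evalBool p (update x j true) - evalBool p (update x j false)) ^ 2 = (2 : ℝ) ^ N * influence j p := by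
  unfold influence boolAvg
  rw [mul_div_cancel₀ _ (by positivity : (2 : ℝ) ^ N ≠ 0)]
  refine Finset.sum_congr rfl fun x _ => ?_
  dsimp only [flipBit]
  rcases Bool.eq_false_or_eq_true (x j) with hx | hx
  · have hu : update x j true = x := by rw [← hx]; exact update_eq_self j x
    rw [hu, hx, Bool.not_true]
  · have hu : update x j false = x := by rw [← hx]; exact update_eq_self j x
    rw [hu, hx, Bool.not_false, ← neg_sub, neg_sq]

/-- **Robust corner (pure OSSS).** For ANY real polynomial `p` and ANY total Boolean function `f` that
`L²`-approximates it to a quarter of the variance — `4·E(p − f)² ≤ Var[p]`, `f` read as `0/1` — some variable has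
`4·Var[p]² ≤ D(f)² · Inf_j[p]`; no pseudo-boundedness needed (`Cov[f, p] ≥ Var[p]/2` by Cauchy–Schwarz, and
`Cov[f, p] ≤ D(f)·maxⱼ E|p(x^{j→1}) − p(x^{j→0})| / 4 ≤ D(f)·√(maxⱼ Infⱼ[p]) / 4` by `osss_depth`).
[cite: OdonnellEtAl2005, Thm 3.2 and the display after it (p. 8)] -/
theorem exists_influence_ge_of_near_boolean (p : MvPolynomial (Fin N) ℝ) (f : (Fin N → Bool) → Bool)
    (happrox : 4 * boolAvg (fun x => (evalBool p x - realOf f x) ^ 2) ≤ boolVariance p)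
    (hv : 0 < boolVariance p) :
    ∃ j : Fin N, 4 * boolVariance p ^ 2 ≤ (detQueryComplexity f : ℝ) ^ 2 * influence j p := by
  classical
  rcases Nat.eq_zero_or_pos N with hN0 | hNpos
  · subst hN0
    exact absurd (boolVariance_fin_zero p) (ne_of_gt hv)
  have hne : (Finset.univ : Finset (Fin N)).Nonempty := ⟨⟨0, hNpos⟩, Finset.mem_univ _⟩
  obtain ⟨j, -, hj⟩ := Finset.exists_max_image Finset.univ (fun j => influence j p) hne
  refine ⟨j, ?_⟩
  obtain ⟨T, hdepth, hcomp⟩ := exists_depth_eq_detQueryComplexity f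
  set g : (Fin N → Bool) → ℝ := evalBool p with hgdef
  set F : (Fin N → Bool) → ℝ := realOf f with hFdef
  set C : ℝ := (2 : ℝ) ^ N with hCdef
  have hC : 0 < C := by rw [hCdef]; positivity
  have hIj := influence_nonneg j p
  set I : ℝ := influence j p with hIdef
  -- `L¹` increments of `g` are at most `C √I`
  have hM : ∀ j' : Fin N, ∑ x, |g (update x j' true) - g (update x j' false)| ≤ C * Real.sqrt I := by
    intro j'
    have h2 : (∑ x, |g (update x j' true) - g (update x j' false)|) ^ 2 ≤ (C * Real.sqrt I) ^ 2 := by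
      calc _ ≤ C * ∑ x, (g (update x j' true) - g (update x j' false)) ^ 2 := sq_sum_abs_le _
        _ = C * (C * influence j' p) := by rw [hgdef, sum_sq_update_eq_influence p j']
        _ ≤ C * (C * I) := by have := hj j' (Finset.mem_univ _); gcongr
        _ = (C * Real.sqrt I) ^ 2 := by rw [mul_pow, Real.sq_sqrt hIj]; ring
    exact (abs_le_of_sq_le_sq' h2 (by positivity)).2
  have hF : ∀ x, F x = if T.eval x = true then (1 : ℝ) else 0 := fun x => by rw [hFdef, realOf_apply, hcomp x]
  have key := osss_depth T F g (C * Real.sqrt I) hF (by positivity) hM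
  -- the left-hand side of OSSS is `C · Σ (F − μ)(g − μ)` with `μ` the mean of `g`
  set μ : ℝ := (∑ x, g x) / C with hμ
  have hcov : C * (∑ x, F x * g x) - (∑ x, F x) * (∑ x, g x) = C * ∑ x, (F x - μ) * (g x - μ) := by
    have hsum : ∑ x, (F x - μ) * (g x - μ)
        = (∑ x, F x * g x) - μ * (∑ x, F x) - μ * (∑ x, g x) + C * μ ^ 2 := by
      have h : ∀ x, (F x - μ) * (g x - μ) = F x * g x - μ * F x - μ * g x + μ ^ 2 := fun x => by ring
      rw [Finset.sum_congr rfl fun x _ => h x, Finset.sum_add_distrib, Finset.sum_sub_distrib,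
        Finset.sum_sub_distrib, ← Finset.mul_sum, ← Finset.mul_sum, Finset.sum_const, Finset.card_univ,
        card_cube_nat, nsmul_eq_mul, hCdef]
      push_cast; ring
    rw [hsum, hμ]
    field_simp
    ring
  -- `Σ (g − μ)² = C · Var[p]`
  have hVar : ∑ x, (g x - μ) ^ 2 = C * boolVariance p := by
    rw [hμ, hCdef, hgdef]
    unfold boolVariance boolAvg
    rw [mul_div_cancel₀ _ (by positivity : (2 : ℝ) ^ N ≠ 0)]
  -- the approximation hypothesis in sum form
  have happrox' : 4 * ∑ x, (g x - F x) ^ 2 ≤ ∑ x, (g x - μ) ^ 2 := by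
    rw [hVar]
    have h1 : boolAvg (fun x => (evalBool p x - realOf f x) ^ 2) = (∑ x, (g x - F x) ^ 2) / C := by
      rw [hCdef, hgdef, hFdef]; rfl
    rw [h1] at happrox
    have := mul_le_mul_of_nonneg_left happrox hC.le
    rwa [← mul_assoc, mul_comm C 4, mul_assoc, mul_div_cancel₀ _ hC.ne'] at this
  have hhalf := half_var_le_sum_centered_mul F g μ happrox'
  -- combine: `C · (C Var)/2 ≤ C Σ (F−μ)(g−μ) ≤ D · C · (C √I)/4`
  rw [hcov, hdepth] at key
  rw [hVar] at hhalf
  have h1 : C * (C * boolVariance p / 2) ≤ (detQueryComplexity f : ℝ) * C * (C * Real.sqrt I) / 4 :=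
    (mul_le_mul_of_nonneg_left hhalf hC.le).trans key
  have h2 : boolVariance p ≤ (detQueryComplexity f : ℝ) * Real.sqrt I / 2 := by
    have h1' : C * C * boolVariance p ≤ C * C * ((detQueryComplexity f : ℝ) * Real.sqrt I / 2) := by
      calc C * C * boolVariance p = 2 * (C * (C * boolVariance p / 2)) := by ring
        _ ≤ 2 * ((detQueryComplexity f : ℝ) * C * (C * Real.sqrt I) / 4) := by linarith
        _ = C * C * ((detQueryComplexity f : ℝ) * Real.sqrt I / 2) := by ring
    exact le_of_mul_le_mul_left h1' (by positivity)
  have hD0 : (0 : ℝ) ≤ (detQueryComplexity f : ℝ) * Real.sqrt I / 2 := by positivity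
  calc 4 * boolVariance p ^ 2 ≤ 4 * ((detQueryComplexity f : ℝ) * Real.sqrt I / 2) ^ 2 := by
        have := pow_le_pow_left₀ hv.le h2 2
        linarith
    _ = (detQueryComplexity f : ℝ) ^ 2 * I := by rw [div_pow, mul_pow, Real.sq_sqrt hIj]; ring

/-- **Robust Boolean corner of `K_T`.** If ANY real polynomial `p` (pseudo-bounded or not) is `L²`-close to a
`{0,1}`-valued member `q` of `K_T` — `4·E(p − q)² ≤ Var[p]` — then some variable has `Var[p]² ≤ 256 · T⁶ · Inf_j[p]`
(`D ≤ 32T³` for the Boolean function of `q`, then the robust corner). So PB-AA can only fail far, in `L²`, from every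
Boolean member of the sandwich class. [cite: OdonnellEtAl2005, Thm 3.2] [cite: Midrijanis2004, Thm 4] -/
theorem exists_influence_ge_of_near_booleanCorner {q : MvPolynomial (Fin N) ℝ} (hq : PseudoBounded T q)
    (hqbool : ∀ x, evalBool q x = 0 ∨ evalBool q x = 1) (p : MvPolynomial (Fin N) ℝ)
    (happrox : 4 * boolAvg (fun x => (evalBool p x - evalBool q x) ^ 2) ≤ boolVariance p)
    (hv : 0 < boolVariance p) :
    ∃ j : Fin N, boolVariance p ^ 2 ≤ 256 * (T : ℝ) ^ 6 * influence j p := by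
  classical
  set f : (Fin N → Bool) → Bool := fun x => decide (evalBool q x = 1) with hf
  have hqf : ∀ x, evalBool q x = realOf f x := by
    intro x
    rw [realOf_apply]
    rcases hqbool x with h0 | h1
    · rw [h0]; simp [hf, h0]
    · rw [h1]; simp [hf, h1]
  have happrox' : 4 * boolAvg (fun x => (evalBool p x - realOf f x) ^ 2) ≤ boolVariance p := by
    have : (fun x => (evalBool p x - realOf f x) ^ 2) = fun x => (evalBool p x - evalBool q x) ^ 2 :=
      funext fun x => by rw [hqf x]
    rw [this]; exact happrox
  obtain ⟨j, hj⟩ := exists_influence_ge_of_near_boolean p f happrox' hv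
  refine ⟨j, ?_⟩
  have hD : (detQueryComplexity f : ℝ) ≤ 32 * (T : ℝ) ^ 3 := by
    exact_mod_cast detQueryComplexity_le_of_pseudoBounded hq f hqf
  have hI := influence_nonneg j p
  have hD0 : (0 : ℝ) ≤ (detQueryComplexity f : ℝ) := by positivity
  have h4 : 4 * boolVariance p ^ 2 ≤ (32 * (T : ℝ) ^ 3) ^ 2 * influence j p :=
    hj.trans (by gcongr)
  nlinarith

end BooleanCorner

end Summit.QuantumAdvantage.QuantumAdvantage.Theorems.SosSandwich

end
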